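import Summits.KontsevichZagierPeriods.KontsevichZagierPeriods.Theorems.LinRedNormalFormArrangementNormalFormStubRebaseSimplePosOneFibreCornerOne

/-!
# Stub `stub_rebaseSimplePosOnePos` (crux `ArrangementNormalForm`, line `janus-bands`) —
part `QuadChart`: the steep blow-up chart in dimension `4` (calculus)

`B = 2` corner calculus, first file. Over the base `(x₁, x₂, y) ∈ ℝ³` with one lettered
fibre `t`, a flat / quadruple point or a double corner of the one-fibre rebase, once moved to
the origin with the pole hyperplane `y = 0`, is resolved on a sector piece
`{0 < x₁ < x₂}` of the silent plane by the rational blow-up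
`(ρ, ξ, η, θ) ↦ (x₁, x₂, y, t) = (ρ, ρ/ξ, ρ η/ξ, ρ θ/ξ)` — radial variable `x₁ = ρ` itself,
`ξ = x₁/x₂ ∈ (0, 1)`, and the distinguished coordinate `y` and the fibre `t` scaled by the
LARGER silent coordinate `x₂ = ρ/ξ` (the four-dimensional version of `RebasePos.blowU`,
part `CornerSteep`). This file is the calculus of the map: `RebasePos.blowQ`, its inverse
`blowQInv`, its derivative `blowQLin` (lower triangular Jacobian matrix `blowQMat`,
determinant `−ρ³/ξ⁴`), the inverse identities, semialgebraicity, and the coordinate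
dictionary `affF_three` / `affB_three` / `glit_three` for `B = 2`. Under the chart every
linear form `m₁ x₁ + m₂ x₂ + m₃ y` becomes `(ρ/ξ)(m₁ ξ + m₂ + m₃ η)`, a form `c + a x₁` stays
`c + a ρ`, a form `c + b x₂` becomes `(c ξ + b ρ)/ξ`: all literal (part `QuadMove`).

References: M. Kontsevich, D. Zagier, *Periods* (2001), §1.2, rule (2).
-/

noncomputable section

open Set MeasureTheory MvPolynomial
open Literature.NumberTheory.Transcendental Literature.ModelTheory.ExponentialFields

namespace Summit.KontsevichZagierPeriods.ArrangementNormalForm.JanusBands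

namespace RebasePos

open SeparatePos

section QuadCoord

/-- The `x₁`-slot of `ℝ⁴ = ℝ^{2+1+1}`. -/
theorem jx1_eq : (Fin.castAdd 1 (Fin.castSucc (0 : Fin 2)) : Fin (2 + 1 + 1)) = 0 := rfl

/-- The `x₂`-slot of `ℝ⁴`. -/
theorem jx2_eq : (Fin.castAdd 1 (Fin.castSucc (1 : Fin 2)) : Fin (2 + 1 + 1)) = 1 := rfl

/-- The `y`-slot of `ℝ⁴`. -/
theorem jy_eq : (Fin.castAdd 1 (Fin.last 2) : Fin (2 + 1 + 1)) = 2 := rfl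

/-- The `t`-slot of `ℝ⁴`. -/
theorem jt_eq : (Fin.natAdd (2 + 1) (0 : Fin 1) : Fin (2 + 1 + 1)) = 3 := rfl

/-- Full-base affine forms over `(x₁, x₂, y)` in coordinates. -/
theorem affF_three (c : (Fin (2 + 1) → ℚ) × ℚ) (z : Fin (2 + 1 + 1) → ℝ) :
    affF 2 1 c z = (c.1 0 : ℝ) * z 0 + (c.1 1 : ℝ) * z 1 + (c.1 2 : ℝ) * z 2 + (c.2 : ℝ) := by
  simp [affF, Fin.sum_univ_three]

/-- Silent affine forms over `(x₁, x₂)` in coordinates. -/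
theorem affB_three (d : (Fin 2 → ℚ) × ℚ) (z : Fin (2 + 1 + 1) → ℝ) :
    affB 2 1 d z = (d.1 0 : ℝ) * z 0 + (d.1 1 : ℝ) * z 1 + (d.2 : ℝ) := by
  simp [affB, Fin.sum_univ_two]

/-- The literal one-fibre integrand with a simple base pole and the letter `0` over the base
`(x₁, x₂, y)`, in coordinates: `R(x₁, x₂)/(y − ℓ₂(x₁, x₂)) · 1/t`. -/
theorem glit_three {m : ℕ} (p : MvPolynomial (Fin 2) ℚ) (L : Fin m → (Fin 2 → ℚ) × ℚ) (e : Fin m → ℕ)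
    (ℓ₁ ℓ₂ : (Fin 2 → ℚ) × ℚ) (z : Fin (2 + 1 + 1) → ℝ) :
    glit 2 1 p L e ℓ₁ ℓ₂ 0 1 (fun _ => some 0) z =
      MvPolynomial.aeval (fun i : Fin 2 => z (Fin.castSucc (Fin.castSucc i))) p / (∏ j, (affB 2 1 (L j) z) ^ e j) *
        (1 / (z 2 - affB 2 1 ℓ₂ z)) * (1 / z 3) := by
  rw [glit_one]
  simp only [pow_zero, pow_one, affF_zero'', sub_zero, jy_eq, jt_eq, one_div]
  rfl

/-- A point of `ℝ⁴` from its four coordinates. -/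
theorem vec4_eq (z : Fin (2 + 1 + 1) → ℝ) : (![z 0, z 1, z 2, z 3] : Fin (2 + 1 + 1) → ℝ) = z := by
  funext l
  fin_cases l <;> rfl

end QuadCoord

section QuadChartData

/-- The steep blow-up in dimension `4`: `(ρ, ξ, η, θ) ↦ (ρ, ρ/ξ, ρ η/ξ, ρ θ/ξ)`. -/
def blowQ (w : Fin (2 + 1 + 1) → ℝ) : Fin (2 + 1 + 1) → ℝ := ![w 0, w 0 / w 1, w 0 * w 2 / w 1, w 0 * w 3 / w 1]

/-- Its inverse `(x₁, x₂, y, t) ↦ (x₁, x₁/x₂, y/x₂, t/x₂)`. -/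
def blowQInv (z : Fin (2 + 1 + 1) → ℝ) : Fin (2 + 1 + 1) → ℝ := ![z 0, z 0 / z 1, z 2 / z 1, z 3 / z 1]

/-- The Jacobian matrix of `blowQ` (lower triangular). -/
def blowQMat (w : Fin (2 + 1 + 1) → ℝ) : Matrix (Fin (2 + 1 + 1)) (Fin (2 + 1 + 1)) ℝ :=
  !![1, 0, 0, 0;
     (w 1)⁻¹, -(w 0 / w 1 ^ 2), 0, 0;
     w 2 / w 1, -(w 0 * w 2 / w 1 ^ 2), w 0 / w 1, 0;
     w 3 / w 1, -(w 0 * w 3 / w 1 ^ 2), 0, w 0 / w 1]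

/-- The derivative of `blowQ`. -/
def blowQLin (w : Fin (2 + 1 + 1) → ℝ) : (Fin (2 + 1 + 1) → ℝ) →L[ℝ] (Fin (2 + 1 + 1) → ℝ) :=
  LinearMap.toContinuousLinearMap (Matrix.toLin' (blowQMat w))

/-- `blowQ` on the `x₁`-slot. -/
@[simp] theorem blowQ_zero (w : Fin (2 + 1 + 1) → ℝ) : blowQ w 0 = w 0 := rfl

/-- `blowQ` on the `x₂`-slot. -/
@[simp] theorem blowQ_one (w : Fin (2 + 1 + 1) → ℝ) : blowQ w 1 = w 0 / w 1 := rfl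

/-- `blowQ` on the `y`-slot. -/
@[simp] theorem blowQ_two (w : Fin (2 + 1 + 1) → ℝ) : blowQ w 2 = w 0 * w 2 / w 1 := rfl

/-- `blowQ` on the `t`-slot. -/
@[simp] theorem blowQ_three (w : Fin (2 + 1 + 1) → ℝ) : blowQ w 3 = w 0 * w 3 / w 1 := rfl

end QuadChartData

section QuadChartCalc

/-- `blowQLin` in coordinates. -/
theorem blowQLin_apply (w v : Fin (2 + 1 + 1) → ℝ) :
    blowQLin w v = ![v 0, (w 1)⁻¹ * v 0 - w 0 / w 1 ^ 2 * v 1,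
      w 2 / w 1 * v 0 - w 0 * w 2 / w 1 ^ 2 * v 1 + w 0 / w 1 * v 2,
      w 3 / w 1 * v 0 - w 0 * w 3 / w 1 ^ 2 * v 1 + w 0 / w 1 * v 3] := by
  rw [blowQLin, LinearMap.coe_toContinuousLinearMap', Matrix.toLin'_apply]
  funext l
  fin_cases l <;> simp [blowQMat, Matrix.mulVec, dotProduct, Fin.sum_univ_four] <;> ring

/-- The Jacobian determinant of `blowQ` is `−ρ³/ξ⁴`. -/
theorem blowQLin_det (w : Fin (2 + 1 + 1) → ℝ) : (blowQLin w).det = -(w 0 ^ 3 / w 1 ^ 4) := by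
  rw [blowQLin, ContinuousLinearMap.det, LinearMap.coe_toContinuousLinearMap, LinearMap.det_toLin',
    Matrix.det_succ_row_zero]
  simp [blowQMat, Fin.sum_univ_succ, Matrix.det_fin_three, Matrix.submatrix_apply, Fin.succAbove]
  ring

/-- `blowQ` has derivative `blowQLin` off `ξ = 0`. -/
theorem hasFDerivAt_blowQ (w : Fin (2 + 1 + 1) → ℝ) (hw : w 1 ≠ 0) : HasFDerivAt blowQ (blowQLin w) w := by
  have h0 := hasFDerivAt_apply (𝕜 := ℝ) (0 : Fin (2 + 1 + 1)) w
  have h1 := hasFDerivAt_apply (𝕜 := ℝ) (1 : Fin (2 + 1 + 1)) w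
  have h2 := hasFDerivAt_apply (𝕜 := ℝ) (2 : Fin (2 + 1 + 1)) w
  have h3 := hasFDerivAt_apply (𝕜 := ℝ) (3 : Fin (2 + 1 + 1)) w
  have hi := (hasFDerivAt_inv hw).comp w h1
  refine hasFDerivAt_pi'' fun l => ?_
  fin_cases l
  · refine (h0.congr_fderiv ?_).congr_of_eventuallyEq (Filter.Eventually.of_forall fun x => rfl)
    ext v
    simp [blowQLin_apply]
  · refine ((h0.mul hi).congr_fderiv ?_).congr_of_eventuallyEq
      (Filter.Eventually.of_forall fun x => by simp [blowQ, div_eq_mul_inv])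
    ext v
    simp [blowQLin_apply]
    field_simp
    ring
  · refine (((h0.mul h2).mul hi).congr_fderiv ?_).congr_of_eventuallyEq
      (Filter.Eventually.of_forall fun x => by simp [blowQ, div_eq_mul_inv])
    ext v
    simp [blowQLin_apply]
    field_simp
    ring
  · refine (((h0.mul h3).mul hi).congr_fderiv ?_).congr_of_eventuallyEq
      (Filter.Eventually.of_forall fun x => by simp [blowQ, div_eq_mul_inv])
    ext v
    simp [blowQLin_apply]
    field_simp
    ring

/-- `blowQ ∘ blowQInv = id` off `x₁ x₂ = 0`. -/
theorem blowQ_blowQInv (z : Fin (2 + 1 + 1) → ℝ) (hz : z 0 ≠ 0) (hz' : z 1 ≠ 0) :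
    blowQ (blowQInv z) = z := by
  funext l
  fin_cases l
  · rfl
  · simp only [blowQ, blowQInv, Fin.mk_one, Matrix.cons_val_one, Matrix.cons_val_zero, Matrix.cons_val]
    field_simp
  · simp only [blowQ, blowQInv, Fin.reduceFinMk, Matrix.cons_val, Matrix.cons_val_zero, Matrix.cons_val_one]
    field_simp
  · simp only [blowQ, blowQInv, Fin.reduceFinMk, Matrix.cons_val, Matrix.cons_val_zero, Matrix.cons_val_one]
    field_simp

/-- `blowQInv ∘ blowQ = id` off `ρ ξ = 0`. -/
theorem blowQInv_blowQ (w : Fin (2 + 1 + 1) → ℝ) (hw : w 0 ≠ 0) (hw' : w 1 ≠ 0) :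
    blowQInv (blowQ w) = w := by
  funext l
  fin_cases l
  · rfl
  · simp only [blowQ, blowQInv, Fin.mk_one, Matrix.cons_val_one, Matrix.cons_val_zero, Matrix.cons_val]
    field_simp
  · simp only [blowQ, blowQInv, Fin.reduceFinMk, Matrix.cons_val, Matrix.cons_val_zero, Matrix.cons_val_one]
    field_simp
  · simp only [blowQ, blowQInv, Fin.reduceFinMk, Matrix.cons_val, Matrix.cons_val_zero, Matrix.cons_val_one]
    field_simp

/-- `blowQ` is a semialgebraic map (a rational map) on every semialgebraic set. -/
theorem isSemialgebraicMapOn_blowQ {R : Set (Fin (2 + 1 + 1) → ℝ)} (hR : IsSemialgebraic ℚ R) :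
    IsSemialgebraicMapOn ℚ R blowQ := by
  refine IsSemialgebraicMapOn.of_forall hR fun j => ?_
  fin_cases j
  · exact (isSemialgebraicFunOn_aeval hR (X 0)).congr fun w _ => by simp [blowQ]
  · exact (IntegrateOut.isSemialgebraicFunOn_div (isSemialgebraicFunOn_aeval hR (X 0))
      (isSemialgebraicFunOn_aeval hR (X 1))).congr fun w _ => by simp [blowQ]
  · exact (IntegrateOut.isSemialgebraicFunOn_div (isSemialgebraicFunOn_aeval hR (X 0 * X 2))
      (isSemialgebraicFunOn_aeval hR (X 1))).congr fun w _ => by simp [blowQ]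
  · exact (IntegrateOut.isSemialgebraicFunOn_div (isSemialgebraicFunOn_aeval hR (X 0 * X 3))
      (isSemialgebraicFunOn_aeval hR (X 1))).congr fun w _ => by simp [blowQ]

/-- `blowQ` is injective on every set where `ρ ξ ≠ 0`. -/
theorem injOn_blowQ {R : Set (Fin (2 + 1 + 1) → ℝ)} (hR : ∀ w ∈ R, w 0 ≠ 0 ∧ w 1 ≠ 0) : InjOn blowQ R :=
  fun w hw w' hw' h => by
    rw [← blowQInv_blowQ w (hR w hw).1 (hR w hw).2, h, blowQInv_blowQ w' (hR w' hw').1 (hR w' hw').2]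

/-- The image of a set under `blowQ`: a point `z` with `x₁ x₂ ≠ 0` is hit iff `blowQInv z` lies in
the set. -/
theorem mem_image_blowQ {R : Set (Fin (2 + 1 + 1) → ℝ)} (hR : ∀ w ∈ R, w 0 ≠ 0 ∧ w 1 ≠ 0)
    {z : Fin (2 + 1 + 1) → ℝ} (hz : z 0 ≠ 0) (hz' : z 1 ≠ 0) : z ∈ blowQ '' R ↔ blowQInv z ∈ R := by
  constructor
  · rintro ⟨w, hw, rfl⟩
    rwa [blowQInv_blowQ w (hR w hw).1 (hR w hw).2]
  · intro h
    exact ⟨blowQInv z, h, blowQ_blowQInv z hz hz'⟩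

/-- The absolute Jacobian determinant on `ρ, ξ > 0`. -/
theorem abs_blowQLin_det (w : Fin (2 + 1 + 1) → ℝ) (hρ : 0 < w 0) (hξ : 0 < w 1) :
    |(blowQLin w).det| = w 0 ^ 3 / w 1 ^ 4 := by
  rw [blowQLin_det, abs_neg, abs_of_pos (div_pos (pow_pos hρ 3) (pow_pos hξ 4))]

end QuadChartCalc

end RebasePos

/-- **Registered part of `stub_rebaseSimplePosOnePos` (line `janus-bands`, `B = 2` corner
calculus): the steep blow-up chart in dimension `4` is a local diffeomorphism with Jacobian
`−ρ³/ξ⁴`.** For `ξ ≠ 0` the rational map `RebasePos.blowQ (ρ, ξ, η, θ) = (ρ, ρ/ξ, ρ η/ξ, ρ θ/ξ)`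
has the derivative `RebasePos.blowQLin` with determinant `−ρ³/ξ⁴`, and `RebasePos.blowQInv`
inverts it where `ρ ξ ≠ 0` (the data of rule 2 for the resolution of flat points and double
corners of the one-fibre rebase over a base of dimension `3`). -/
theorem rebaseSimplePos_quadChart (w : Fin (2 + 1 + 1) → ℝ) (hρ : w 0 ≠ 0) (hξ : w 1 ≠ 0) : HasFDerivAt RebasePos.blowQ (RebasePos.blowQLin w) w ∧ (RebasePos.blowQLin w).det = -(w 0 ^ 3 / w 1 ^ 4) ∧ RebasePos.blowQInv (RebasePos.blowQ w) = w :=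
  ⟨RebasePos.hasFDerivAt_blowQ w hξ, RebasePos.blowQLin_det w, RebasePos.blowQInv_blowQ w hρ hξ⟩

end Summit.KontsevichZagierPeriods.ArrangementNormalForm.JanusBands
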